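/-
Literature/NumberTheory/ComplexMultiplication/DegenerateCMTypesAbelianKernelsExponentTwiceOdd.lean — pub-hodgecm2 (COR-CM), KEPT Literature
lane lit-deligne-3 gen 66, file F66e.  THEOREMS ONLY (no `def`, no named fact, no `sorry`, no instance, no notation; D-0026 net debt 0).
HC_CM is NOT proved.
-/
import Literature.NumberTheory.ComplexMultiplication.DegenerateCMTypesAbelianKernelsIndexTwicePrimePowers
import HarnessLib

/-!
# The rank of a CM type by kernels in EXPONENT `2m`, `m` ODD ARBITRARY (any finite abelian group):
# `rank(T) + #B₂(T) + Σ_{1 ≠ d ∣ m} φ(2d)·#B_d(T) = |G|/2 + 1`, every index class decided by mixed differences at the kernels with cyclic quotient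

Topic `Literature/NumberTheory/ComplexMultiplication` (namespace `Literature.NumberTheory.ComplexMultiplication.CyclicCMType.AbelianKernels`); cell
`pub-hodgecm2` (COR-CM), KEPT Literature lane `lit-deligne-3` gen 66, file F66e — the GROUP-LEVEL synthesis of the lane's ARBITRARY-ODD-PART programme:
Kubota's defect regrouped by kernels, the index classes indexed by the DIVISORS `d ≠ 1` of `m` and each class decided by the lane's F66c.  The squarefree
case is the lane's F65g (`typeRank_add_card_add_sum_totient_mul_card_eq`, classes = sets of prime divisors; there every subgroup of index `2d` has cyclic
quotient, here cyclicity of `G/H` is a CLAUSE of the class).  KERNEL ONLY: theorems; no `def`, no named fact, no instance, no notation (D-0014 ∕ D-0026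
net debt `0`).  HC_CM is NOT proved here or anywhere in the lane.

## Mathematics

T. Kubota [Kubota1965], §4 LEMMA 2: for a finite abelian group `G ∋ ρ` (`ρ² = 1`) and a CM type `T` (`T ⊔ ρT = G`) the DEFECT `|G|/2 + 1 − rank(T)`
is the number of odd characters vanishing on `T`; grouped by KERNEL (White's proof of his Lemma 3 [White1993SporadicCycles]; tree
`typeRank_add_sum_totient_eq`): `rank(T) + Σ_H φ([G:H]) = |G|/2 + 1` over the ADMISSIBLE kernels `H ∌ ρ`, `G/H` cyclic, all of whose characters
vanish on `T`.  If `g^{2m} = 1` on `G` with `m` odd, an admissible kernel has index `2d` with `d ∣ m` (the index divides the exponent and is even since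
`ρ ∉ H`; **`index_div_two_dvd_of_exponent_two_mul`**).  The class `d = 1` (index `2`, quotient automatically cyclic) is decided by even splitting
`#(T ∩ H) = #(T ∖ H)` ([Dodson1984] §3.1.1; tree `…iff_of_index_two`), the classes `d ≠ 1` by the lane's F66c ([Hazama2003CyclicCM] Lemma 4.6.1
mechanism + the Rédei ∕ de Bruijn ∕ Schoenberg relations for arbitrary order, [LamLeung2000] Thm. 2.2): `Σ_{ε∈{0,1}^{primes(d)}} (−1)^{|ε|}
#(T ∩ g·Π_{ε_q=1} x_q·H) = 0` for all `g` and all `x_q` with `x_q^q ∈ H`.  Hence, EXACTLY,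

  **`rank(T) + #B₂(T) + Σ_{d ∣ m, d ≠ 1} φ(2d) · #B_d(T) = |G|/2 + 1`**  (`typeRank_add_card_add_sum_divisors_totient_mul_card_eq`)

with `B_d(T)` the subgroups `H ∌ ρ` of index `2d` WITH CYCLIC QUOTIENT at which those mixed differences vanish, and `T` is NONDEGENERATE iff `B₂(T) = ∅`
and `B_d(T) = ∅` for every divisor `d ≠ 1` of `m` (`typeRank_eq_iff_of_exponent_two_mul_odd`).  The field reading (CM subfields of degree `2d` with
cyclic Galois group over which the type has vanishing mixed differences) follows by the lane's general dictionary
(`MixedDifferencesReading.card_index_isCyclic_eq_ncard_mixed`).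

* §0 private helpers (suffix `_eo`): `index_dvd_and_two_dvd_eo`, `isCyclic_quotient_of_index_two_eo`; public **`index_div_two_dvd_of_exponent_two_mul`**.
* §1 **`typeRank_add_card_add_sum_divisors_totient_mul_card_eq`** (the admissible kernels are partitioned by `H ↦ [G:H]/2 ∈ divisors(m)` with
  `Finset.sum_fiberwise_of_maps_to`, each fibre identified with `B_d` by F66c's `forall_sum_char_eq_zero_iff_alternatingSum_of_index_two_mul_odd`),
  **`typeRank_eq_iff_of_exponent_two_mul_odd`**.

PRESEARCH (lane rule): as for F65g ∕ F66c — the regrouped Kubota count with all index classes decided is not found as printed for a general odd `m`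
(corpus hybrid «rank of CM type abelian CM field exponent characters kernel divisors», galaxy «degenerate CM type | rank of a CM-type | index of
degeneracy», all stars: 0 relevant, lane queries gen 64–66; the ingredients are Kubota's Lemma 2, White's regrouping, Dodson's index 2, Hazama's mechanism
and [LamLeung2000] Thm. 2.2); recorded as the lane's own elementary theorem with those citations.

HONEST REGISTER.  Unconditional and elementary given the tree.  Exponent `2m` only (`2`-part of the exponent exactly `2`); nothing is claimed about the
Hodge classes of degenerate types.  HC_CM is NOT proved and not used.

## References

* [Kubota1965] T. Kubota, *On the field extension by complex multiplication*, Trans. AMS 118 (1965), §4 Lemma 2.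
* [White1993SporadicCycles] S. P. White, *Sporadic cycles on CM abelian varieties*, Compositio Math. 88 (1993), §4, proof of Lemma 3 (p. 131).
* [Dodson1984] B. Dodson, *The structure of Galois groups of CM-fields*, Trans. AMS 283 (1984), §3.1.1 Theorem.
* [Hazama2003CyclicCM] F. Hazama, *Hodge cycles on abelian varieties with complex multiplication by cyclic CM-fields*, J. Math. Sci. Univ. Tokyo 10
  (2003): Prop. 4.3, Lemma 4.6.1, Thm. 4.8.
* [LamLeung2000] T. Y. Lam, K. H. Leung, *On vanishing sums of roots of unity*, J. Algebra 224 (2000), Thm. 2.2 (via the lane's F66b ∕ F66c).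

## Provenance

Cell `pub-hodgecm2` (COR-CM), KEPT Literature lane `lit-deligne-3` gen 66 (claim ABELIAN-EXPONENT-2ODD-RANK; count-neutral, own lane), file F66e;
neighbours cited by name, nothing restated: `DegenerateCMTypesAbelianKernels` (`typeRank_add_sum_totient_eq`, `forall_sum_char_eq_zero_iff_of_index_two`),
`DegenerateCMTypesAbelianKernelsIndexTwicePrimePowers` (F66c `…_of_index_two_mul_odd`).  The proof text is the lane's F65g with divisor classes.
Theorems only; net Literature debt 0.
-/

noncomputable section

open scoped BigOperators Classical

namespace Literature.NumberTheory.ComplexMultiplication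

namespace CyclicCMType

namespace AbelianKernels

variable {G : Type*} [CommGroup G] [Fintype G] [DecidableEq G] {ρ : G} {T : Finset G} {m : ℕ}

/-! ## §0 Helpers: admissible kernels in exponent `2m` -/

section Helpers

omit [Fintype G] [DecidableEq G] in
/-- The index of an admissible kernel divides the exponent `2m` and is even. [folklore] -/
private theorem index_dvd_and_two_dvd_eo (hexp : ∀ g : G, g ^ (2 * m) = 1) {H : Subgroup G} (hρH : ρ ∉ H) (hρ2 : ρ * ρ = 1)
    (hcyc : IsCyclic (G ⧸ H)) : H.index ∣ 2 * m ∧ 2 ∣ H.index := by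
  haveI := hcyc
  refine ⟨?_, ?_⟩
  · rw [Subgroup.index_eq_card, ← IsCyclic.exponent_eq_card]
    exact Monoid.exponent_dvd_of_forall_pow_eq_one fun x => QuotientGroup.induction_on x fun g => by
      rw [← QuotientGroup.mk_pow, hexp, QuotientGroup.mk_one]
  · have hρ1 : (ρ : G ⧸ H) ≠ 1 := fun h => hρH ((QuotientGroup.eq_one_iff ρ).1 h)
    have hord : orderOf (ρ : G ⧸ H) = 2 := by
      haveI : Fact (Nat.Prime 2) := ⟨Nat.prime_two⟩
      refine orderOf_eq_prime ?_ hρ1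
      rw [pow_two, ← QuotientGroup.mk_mul, hρ2, QuotientGroup.mk_one]
    rw [Subgroup.index_eq_card, ← hord]
    exact orderOf_dvd_natCard _

omit [Fintype G] [DecidableEq G] in
/-- `G/H` is cyclic for `H` of index `2`. [folklore] -/
private theorem isCyclic_quotient_of_index_two_eo [Finite G] {H : Subgroup G} (hidx : H.index = 2) : IsCyclic (G ⧸ H) := by
  haveI : Fact (Nat.Prime 2) := ⟨Nat.prime_two⟩
  exact isCyclic_of_prime_card (p := 2) (by rw [← Subgroup.index_eq_card, hidx])

omit [Fintype G] [DecidableEq G] in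
/-- **The admissible kernels in exponent `2m`**: a subgroup `H ∌ ρ` with cyclic quotient in a commutative group killed by `2m` has index `2d` with
`d = [G:H]/2` a divisor of `m`. [cite: Kubota1965, §4 Lemma 2] [cite: White1993SporadicCycles, §4, proof of Lemma 3 (p. 131)] -/
theorem index_div_two_dvd_of_exponent_two_mul (hexp : ∀ g : G, g ^ (2 * m) = 1) {H : Subgroup G} (hρH : ρ ∉ H) (hρ2 : ρ * ρ = 1)
    (hcyc : IsCyclic (G ⧸ H)) : H.index / 2 ∣ m ∧ H.index = 2 * (H.index / 2) := by
  obtain ⟨hdvd, h2⟩ := index_dvd_and_two_dvd_eo hexp hρH hρ2 hcyc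
  have hidx : H.index = 2 * (H.index / 2) := (Nat.mul_div_cancel' h2).symm
  exact ⟨Nat.dvd_of_mul_dvd_mul_left two_pos (hidx ▸ hdvd), hidx⟩

end Helpers

/-! ## §1 The rank of a CM type in exponent `2m` (`m` odd): Kubota's defect by kernels, every index class decided -/

section ExponentTwiceOdd

/-- **THE RANK OF A CM TYPE BY KERNELS, EXPONENT `2m` WITH `m` ODD** (any finite commutative group `G` with `g^{2m} = 1`, conjugation `ρ`, CM type `T`,
i.e. `T ⊔ ρT = G`):

  `rank(T) + #B₂(T) + Σ_{d ∣ m, d ≠ 1} φ(2d) · #B_d(T) = |G|/2 + 1`,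

where `B₂(T)` is the set of index-`2` subgroups `H ∌ ρ` splitting `T` evenly (`#(T ∩ H) = #(T ∖ H)`) and, for a divisor `d ≠ 1` of `m`, `B_d(T)` is the
set of subgroups `H ∌ ρ` of index `2d` WITH `G/H` CYCLIC at which the mixed differences of the coset counts of `T` along the prime torsion of the odd
part of `G/H` vanish: `Σ_{ε ∈ {0,1}^{primes(d)}} (−1)^{|ε|} #(T ∩ g·Π_{ε_q = 1} x_q·H) = 0` for all `g ∈ G` and all `x_q` (`q ∣ d` prime) with `x_q^q ∈ H`.
Kubota's defect `Σ_H φ([G:H])` over the admissible kernels (tree `typeRank_add_sum_totient_eq`): every admissible kernel has index `2d`, `d ∣ m`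
(`index_div_two_dvd_of_exponent_two_mul`); the class `d = 1` is decided by even splitting (Dodson, tree `…iff_of_index_two`), the classes `d ≠ 1` by the
lane's F66c (`…alternatingSum_of_index_two_mul_odd`).  The squarefree case (all quotients of order `2d` cyclic, classes = sets of primes) is the lane's
F65g. [cite: Kubota1965, §4 Lemma 2] [cite: White1993SporadicCycles, §4, proof of Lemma 3 (p. 131)] [cite: Hazama2003CyclicCM, Prop. 4.3, Lemma 4.6.1 and Thm. 4.8]
[cite: Dodson1984, §3.1.1 Theorem] [cite: LamLeung2000, Thm. 2.2] -/
theorem typeRank_add_card_add_sum_divisors_totient_mul_card_eq (hodd : ¬ 2 ∣ m)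
    (h : IsCMTypeWith ρ (T : Set G)) (hexp : ∀ g : G, g ^ (2 * m) = 1) :
    typeRank G (T : Set G) +
      ((Finset.univ : Finset (Subgroup G)).filter fun H => ρ ∉ H ∧ H.index = 2 ∧
        (T.filter fun s => s ∈ H).card = (T.filter fun s => s ∉ H).card).card +
      ∑ d ∈ m.divisors.erase 1,
        (2 * d).totient *
          ((Finset.univ : Finset (Subgroup G)).filter fun H => ρ ∉ H ∧ H.index = 2 * d ∧ IsCyclic (G ⧸ H) ∧
            ∀ (g : G) (x : ↥d.primeFactors → G), (∀ q, x q ^ (q : ℕ) ∈ H) →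
              ∑ ε : ↥d.primeFactors → Bool, (∏ q, (if ε q then (-1 : ℤ) else 1)) *
                ((T.filter fun s => (g * ∏ q, (if ε q then x q else 1))⁻¹ * s ∈ H).card : ℤ) = 0).card =
      Fintype.card G / 2 + 1 := by
  have hρ2 : ρ * ρ = 1 := by simpa [smul_eq_mul] using h.invol (1 : G)
  have key := typeRank_add_sum_totient_eq h
  have hm0 : m ≠ 0 := by
    rintro rfl
    exact hodd (dvd_zero 2)
  set A := (Finset.univ : Finset (Subgroup G)).filter (fun H => ρ ∉ H ∧ IsCyclic (G ⧸ H) ∧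
    ∀ χ : AddChar (Additive G) ℂ, (∀ g : G, χ (Additive.ofMul g) = 1 ↔ g ∈ H) →
      ∑ s ∈ T, χ (Additive.ofMul s) = 0) with hA
  set B₂ := (Finset.univ : Finset (Subgroup G)).filter (fun H => ρ ∉ H ∧ H.index = 2 ∧
    (T.filter fun s => s ∈ H).card = (T.filter fun s => s ∉ H).card) with hB₂
  -- the index class of a subgroup: half its index
  set cls : Subgroup G → ℕ := fun H => H.index / 2 with hcls
  have hclsd : ∀ (d : ℕ) (H : Subgroup G), H.index = 2 * d → cls H = d := by
    intro d H hidx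
    rw [hcls]
    dsimp only
    rw [hidx, Nat.mul_div_cancel_left _ two_pos]
  -- every admissible kernel lies in the class of a divisor of `m`
  have hmaps : ∀ H ∈ A, cls H ∈ m.divisors := by
    intro H hH
    rw [hA, Finset.mem_filter] at hH
    exact Nat.mem_divisors.2 ⟨(index_div_two_dvd_of_exponent_two_mul hexp hH.2.1 hρ2 hH.2.2.1).1, hm0⟩
  have hidxA : ∀ H ∈ A, H.index = 2 * cls H := by
    intro H hH
    rw [hA, Finset.mem_filter] at hH
    exact (index_div_two_dvd_of_exponent_two_mul hexp hH.2.1 hρ2 hH.2.2.1).2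
  -- §A the class `d = 1`: index `2`, decided by even splitting
  have hfib0 : A.filter (fun H => cls H = 1) = B₂ := by
    rw [hA, hB₂, Finset.filter_filter]
    refine Finset.filter_congr fun H _ => ?_
    constructor
    · rintro ⟨⟨hρH, hcyc, hchar⟩, hc⟩
      have hidx : H.index = 2 := by
        have := (index_div_two_dvd_of_exponent_two_mul hexp hρH hρ2 hcyc).2
        rw [show H.index / 2 = 1 from hc, mul_one] at this
        exact this
      exact ⟨hρH, hidx, (forall_sum_char_eq_zero_iff_of_index_two hρ2 hρH hidx T).1 hchar⟩
    · rintro ⟨hρH, hidx, hsplit⟩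
      exact ⟨⟨hρH, isCyclic_quotient_of_index_two_eo hidx, (forall_sum_char_eq_zero_iff_of_index_two hρ2 hρH hidx T).2 hsplit⟩,
        hclsd 1 H (by rw [mul_one]; exact hidx)⟩
  -- §B the classes `d ≠ 1`: decided by the mixed-difference criterion (F66c, family indexed by the primes of `d`)
  have hfibD : ∀ d ∈ m.divisors, d ≠ 1 →
      A.filter (fun H => cls H = d) =
        (Finset.univ : Finset (Subgroup G)).filter fun H => ρ ∉ H ∧ H.index = 2 * d ∧ IsCyclic (G ⧸ H) ∧
          ∀ (g : G) (x : ↥d.primeFactors → G), (∀ q, x q ^ (q : ℕ) ∈ H) →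
            ∑ ε : ↥d.primeFactors → Bool, (∏ q, (if ε q then (-1 : ℤ) else 1)) *
              ((T.filter fun s => (g * ∏ q, (if ε q then x q else 1))⁻¹ * s ∈ H).card : ℤ) = 0 := by
    intro d hd hd1
    have hd2 : ¬ 2 ∣ d := fun h2 => hodd (h2.trans (Nat.dvd_of_mem_divisors hd))
    rw [hA, Finset.filter_filter]
    refine Finset.filter_congr fun H _ => ?_
    constructor
    · rintro ⟨⟨hρH, hcyc, hchar⟩, hc⟩
      have hidx : H.index = 2 * d := by rw [← hc]; exact hidxA H (by rw [hA, Finset.mem_filter]; exact ⟨Finset.mem_univ _, hρH, hcyc, hchar⟩)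
      exact ⟨hρH, hidx, hcyc, (forall_sum_char_eq_zero_iff_alternatingSum_of_index_two_mul_odd hd1 hd2 h hρH hcyc hidx).1 hchar⟩
    · rintro ⟨hρH, hidx, hcyc, hcrit⟩
      exact ⟨⟨hρH, hcyc, (forall_sum_char_eq_zero_iff_alternatingSum_of_index_two_mul_odd hd1 hd2 h hρH hcyc hidx).2 hcrit⟩, hclsd d H hidx⟩
  -- §C Euler's `φ` summed by classes
  have hsum : ∑ H ∈ A, H.index.totient = ∑ d ∈ m.divisors, (2 * d).totient * (A.filter fun H => cls H = d).card := by
    rw [← Finset.sum_fiberwise_of_maps_to hmaps]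
    refine Finset.sum_congr rfl fun d _ => ?_
    have hconst : ∀ H ∈ A.filter (fun H => cls H = d), H.index.totient = (2 * d).totient := by
      intro H hH
      rw [Finset.mem_filter] at hH
      rw [hidxA H hH.1, hH.2]
    rw [Finset.sum_congr rfl hconst, Finset.sum_const, smul_eq_mul, mul_comm]
  have hsplit : ∑ d ∈ m.divisors, (2 * d).totient * (A.filter fun H => cls H = d).card =
      B₂.card + ∑ d ∈ m.divisors.erase 1, (2 * d).totient * (A.filter fun H => cls H = d).card := by
    rw [Finset.sum_eq_add_sum_sdiff_singleton_of_mem (Nat.one_mem_divisors.2 hm0), mul_one, Nat.totient_two, one_mul, hfib0,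
      Finset.sdiff_singleton_eq_erase]
  have hsumD : ∑ d ∈ m.divisors.erase 1, (2 * d).totient * (A.filter fun H => cls H = d).card =
      ∑ d ∈ m.divisors.erase 1, (2 * d).totient *
          ((Finset.univ : Finset (Subgroup G)).filter fun H => ρ ∉ H ∧ H.index = 2 * d ∧ IsCyclic (G ⧸ H) ∧
            ∀ (g : G) (x : ↥d.primeFactors → G), (∀ q, x q ^ (q : ℕ) ∈ H) →
              ∑ ε : ↥d.primeFactors → Bool, (∏ q, (if ε q then (-1 : ℤ) else 1)) *
                ((T.filter fun s => (g * ∏ q, (if ε q then x q else 1))⁻¹ * s ∈ H).card : ℤ) = 0).card :=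
    Finset.sum_congr rfl fun d hd => by rw [hfibD d (Finset.mem_of_mem_erase hd) (Finset.ne_of_mem_erase hd)]
  rw [hsum, hsplit, hsumD, ← add_assoc] at key
  exact key

/-- **NONDEGENERATE iff no index-`2` subgroup `H ∌ ρ` splits the type evenly and, for every divisor `d ≠ 1` of `m`, the mixed differences of the coset
counts along the prime torsion vanish at NO subgroup `H ∌ ρ` of index `2d` with cyclic quotient** (exponent `2m`, `m` odd).
[cite: Kubota1965, §4 Lemma 2] [cite: Hazama2003CyclicCM, Prop. 4.3 and Thm. 4.8] [cite: Dodson1984, §3.1.1 Theorem] -/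
theorem typeRank_eq_iff_of_exponent_two_mul_odd (hodd : ¬ 2 ∣ m)
    (h : IsCMTypeWith ρ (T : Set G)) (hexp : ∀ g : G, g ^ (2 * m) = 1) :
    typeRank G (T : Set G) = Fintype.card G / 2 + 1 ↔
      (∀ H : Subgroup G, ρ ∉ H → H.index = 2 → (T.filter fun s => s ∈ H).card ≠ (T.filter fun s => s ∉ H).card) ∧
      ∀ d : ℕ, d ∣ m → d ≠ 1 → ∀ H : Subgroup G, ρ ∉ H → H.index = 2 * d → IsCyclic (G ⧸ H) →
        ¬ ∀ (g : G) (x : ↥d.primeFactors → G), (∀ q, x q ^ (q : ℕ) ∈ H) →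
          ∑ ε : ↥d.primeFactors → Bool, (∏ q, (if ε q then (-1 : ℤ) else 1)) *
            ((T.filter fun s => (g * ∏ q, (if ε q then x q else 1))⁻¹ * s ∈ H).card : ℤ) = 0 := by
  have key := typeRank_add_card_add_sum_divisors_totient_mul_card_eq hodd h hexp
  have hm0 : m ≠ 0 := by
    rintro rfl
    exact hodd (dvd_zero 2)
  set b := ((Finset.univ : Finset (Subgroup G)).filter fun H => ρ ∉ H ∧ H.index = 2 ∧
        (T.filter fun s => s ∈ H).card = (T.filter fun s => s ∉ H).card).card with hb
  set F : ℕ → ℕ := fun d => (2 * d).totient *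
          ((Finset.univ : Finset (Subgroup G)).filter fun H => ρ ∉ H ∧ H.index = 2 * d ∧ IsCyclic (G ⧸ H) ∧
            ∀ (g : G) (x : ↥d.primeFactors → G), (∀ q, x q ^ (q : ℕ) ∈ H) →
              ∑ ε : ↥d.primeFactors → Bool, (∏ q, (if ε q then (-1 : ℤ) else 1)) *
                ((T.filter fun s => (g * ∏ q, (if ε q then x q else 1))⁻¹ * s ∈ H).card : ℤ) = 0).card with hF
  have key' : typeRank G (T : Set G) + (b + ∑ d ∈ m.divisors.erase 1, F d) = Fintype.card G / 2 + 1 := by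
    rw [← add_assoc]; exact key
  have hiff : typeRank G (T : Set G) = Fintype.card G / 2 + 1 ↔ b = 0 ∧ ∀ d ∈ m.divisors.erase 1, F d = 0 := by
    rw [← Finset.sum_eq_zero_iff]
    constructor
    · intro hr
      rw [hr] at key'
      constructor <;> omega
    · rintro ⟨h0, h1⟩
      rw [h0, h1, add_zero, add_zero] at key'
      exact key'
  rw [hiff]
  refine and_congr ?_ ?_
  · rw [hb, Finset.card_eq_zero, Finset.filter_eq_empty_iff]
    constructor
    · intro hno H hρH hidx heq
      exact hno (Finset.mem_univ H) ⟨hρH, hidx, heq⟩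
    · rintro hno H - ⟨hρH, hidx, heq⟩
      exact hno H hρH hidx heq
  · constructor
    · intro hno d hd hd1 H hρH hidx hcyc hcrit
      have h0 := hno d (Finset.mem_erase.2 ⟨hd1, Nat.mem_divisors.2 ⟨hd, hm0⟩⟩)
      rw [hF] at h0
      dsimp only at h0
      rcases Nat.mul_eq_zero.1 h0 with h0 | h0
      · exact absurd h0 (Nat.pos_iff_ne_zero.1 (Nat.totient_pos.2 (Nat.mul_pos two_pos (Nat.pos_of_dvd_of_pos hd (Nat.pos_of_ne_zero hm0)))))
      · rw [Finset.card_eq_zero, Finset.filter_eq_empty_iff] at h0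
        exact h0 (Finset.mem_univ H) ⟨hρH, hidx, hcyc, hcrit⟩
    · intro hno d hd
      rw [Finset.mem_erase] at hd
      rw [hF]
      dsimp only
      rw [Nat.mul_eq_zero]
      right
      rw [Finset.card_eq_zero, Finset.filter_eq_empty_iff]
      rintro H - ⟨hρH, hidx, hcyc, hcrit⟩
      exact hno d (Nat.dvd_of_mem_divisors hd.2) hd.1 H hρH hidx hcyc hcrit

end ExponentTwiceOdd

end AbelianKernels

end CyclicCMType

end Literature.NumberTheory.ComplexMultiplication

end
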